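import Literature.IUT.LogVolume.DifferentOrdGaloisFibre
import HarnessLib

/-!
# Weight descent along a finite extension: `Σ_{w⃗ over v⃗} Pr_K(w⃗) = Pr_{F₀}(v⃗)`

Dupuy–Hilado, *Statement of Mochizuki's Cor. 3.12* (arXiv:2004.13228) §3.6 gives the finite places `V(F)_p` of a
number field `F` over a rational prime `p` the probability weights `Pr(v) = [F_v:ℚ_p]/[F:ℚ] = n_v/[F:ℚ]`
(tree: `Literature.IUT.LogVolume.weight`, `FakeAdeleIndex.lean`), and tuples `v⃗ = (v_0,…,v_j) ∈ V(F)_p^{j+1}` the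
product weights `Pr(v⃗) = Π_a Pr(v_a)` (the weights of the `(j+1)`-tensor packets of [IUTchIII] Rmk. 3.1.1 (ii) /
[IUTchIV] Thm. 1.10 Step (v) "after passing to weighted averages").  For a finite extension of number fields
`K/F₀` the weights DESCEND along the fibres of `V(K)_p → V(F₀)_p`, `w ↦ w ∩ 𝓞_{F₀}` (`finBelow`): by the
fundamental identity `Σ_{w | v} e(w|v)·f(w|v) = [K:F₀]` (Neukirch, *Algebraic Number Theory*, Ch. I (8.2); in the
tree as `sum_filter_finBelow_localDegree`: `Σ_{w|v} n_w = [K:F₀]·n_v`) and the tower law `[K:ℚ] = [K:F₀]·[F₀:ℚ]`,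

* `sum_filter_finBelow_weight` — **one place**: `Σ_{w ∈ V(K)_p, w|v} Pr_K(w) = Pr_{F₀}(v)`;
* `sum_piFinset_prod_weight_eq` — **tuples**: `Σ_{w⃗ ∈ Π_a {w | v_a}} Π_a Pr_K(w_a) = Π_a Pr_{F₀}(v_a)`
  (distribute the product over the coordinatewise fibre sums, `Finset.prod_univ_sum`);
* `sum_subtype_placesOver_prod_weight_eq` — the same indexed by the subtype of
  tuples of places of `K` over `p` lying coordinatewise over `v⃗` (the shape in which an `F`-level packet average
  is compared with an `F₀`-level one).

No Galois hypothesis is needed for the weight identity itself; Galois-invariance of a SUMMAND (so that an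
`F`-level weighted average over the fibre collapses to the `F₀`-level term) is the consumer's business.
Classical; theorems only, no definitions. Written for the abc-iut cell (G1-Θ SHAPES, item (W) "weight descent",
route α; reusable for any comparison of `Pr`-averages along `K ⊇ F₀`). Nothing here bears on [IUTchIII] Cor. 3.12.
-/

noncomputable section

namespace Literature.IUT.LogVolume

open NumberField IsDedekindDomain Finset

variable (F₀ K : Type) [Field F₀] [NumberField F₀] [Field K] [NumberField K] [Algebra F₀ K]

open scoped Classical in
/-- **Weight descent at one place**: for `v ∈ V(F₀)_p`, `Σ_{w ∈ V(K)_p, w | v} Pr_K(w) = Pr_{F₀}(v)`, i.e.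
`Σ_{w|v} n_w/[K:ℚ] = n_v/[F₀:ℚ]` — the fundamental identity `Σ_{w|v} n_w = [K:F₀]·n_v` divided by the tower
law `[K:ℚ] = [F₀:ℚ]·[K:F₀]`. [cite: NeukirchANT1999, Ch. I §8 Prop. (8.2)] [cite: DupuyHilado2025, §3.6] -/
theorem sum_filter_finBelow_weight {p : ℕ} [Fact p.Prime] (v : HeightOneSpectrum (𝓞 F₀))
    (hv : v ∈ placesOver F₀ p) :
    ∑ w ∈ (placesOver K p).filter (fun w => finBelow F₀ K w = v), weight K w = weight F₀ v := by
  have hK : (0 : ℝ) < Module.finrank ℚ K := by exact_mod_cast Module.finrank_pos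
  have hF : (0 : ℝ) < Module.finrank ℚ F₀ := by exact_mod_cast Module.finrank_pos
  have hKF : (0 : ℝ) < Module.finrank F₀ K := by exact_mod_cast Module.finrank_pos
  have htower : (Module.finrank ℚ K : ℝ) = Module.finrank ℚ F₀ * Module.finrank F₀ K := by
    exact_mod_cast (Module.finrank_mul_finrank ℚ F₀ K).symm
  simp only [weight]
  rw [← Finset.sum_div, sum_filter_finBelow_localDegree F₀ K v hv, htower]
  field_simp

open scoped Classical in
/-- **Weight descent for tuples** (`(j+1)`-packets, any finite index type `ι`): for `v⃗ : ι → V(F₀)_p`,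
`Σ_{w⃗ ∈ Π_a {w ∈ V(K)_p : w | v_a}} Π_a Pr_K(w_a) = Π_a Pr_{F₀}(v_a)` — distribute the product over the
coordinatewise fibre sums and descend each by `sum_filter_finBelow_weight`.
[cite: DupuyHilado2025, §3.6] [cite: Mochizuki2012, IUTchIV Thm. 1.10 proof Step (v) p. 28] -/
theorem sum_piFinset_prod_weight_eq {p : ℕ} [Fact p.Prime] {ι : Type} [Fintype ι] [DecidableEq ι]
    (v : ι → HeightOneSpectrum (𝓞 F₀)) (hv : ∀ a, v a ∈ placesOver F₀ p) :
    ∑ w ∈ Fintype.piFinset (fun a => (placesOver K p).filter (fun w => finBelow F₀ K w = v a)),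
        ∏ a, weight K (w a) = ∏ a, weight F₀ (v a) := by
  rw [← Finset.prod_univ_sum]
  exact Finset.prod_congr rfl fun a _ => sum_filter_finBelow_weight F₀ K (v a) (hv a)

open scoped Classical in
/-- **Weight descent for tuples of places over `p`, subtype form** (the packet-summand indexing
`w⃗ : ι → V(K)_p`, `v⃗ : ι → V(F₀)_p`): the sum of `Π_a Pr_K(w_a)` over the tuples `w⃗` lying coordinatewise over
`v⃗` equals `Π_a Pr_{F₀}(v_a)` (finiteness of the index type via classical decidability of the fibre condition).
[cite: DupuyHilado2025, §3.6] [cite: Mochizuki2012, IUTchIII Rmk. 3.1.1 (ii) p. 94] -/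
theorem sum_subtype_placesOver_prod_weight_eq {p : ℕ} [Fact p.Prime] {ι : Type} [Fintype ι] [DecidableEq ι]
    (v : ι → placesOver F₀ p) :
    ∑ w : {w : ι → placesOver K p // ∀ a, finBelow F₀ K (w a).1 = (v a).1},
        ∏ a, weight K (w.1 a).1 = ∏ a, weight F₀ (v a).1 := by
  classical
  -- the tuples in the product of the fibres ARE the tuples of places over `p` lying over `v⃗`
  let T : Finset (ι → HeightOneSpectrum (𝓞 K)) :=
    Fintype.piFinset fun a => (placesOver K p).filter (fun w => finBelow F₀ K w = (v a).1)
  have hmem : ∀ w : ι → HeightOneSpectrum (𝓞 K),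
      w ∈ T ↔ ∀ a, w a ∈ placesOver K p ∧ finBelow F₀ K (w a) = (v a).1 := fun w => by
    simp only [T, Fintype.mem_piFinset, Finset.mem_filter]
  let e : {w : ι → placesOver K p // ∀ a, finBelow F₀ K (w a).1 = (v a).1} → ↥T :=
    fun u => ⟨fun a => (u.1 a).1, (hmem _).2 fun a => ⟨(u.1 a).2, u.2 a⟩⟩
  let e' : ↥T → {w : ι → placesOver K p // ∀ a, finBelow F₀ K (w a).1 = (v a).1} :=
    fun w => ⟨fun a => ⟨w.1 a, (((hmem w.1).1 w.2) a).1⟩, fun a => (((hmem w.1).1 w.2) a).2⟩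
  let E : {w : ι → placesOver K p // ∀ a, finBelow F₀ K (w a).1 = (v a).1} ≃ ↥T :=
    { toFun := e, invFun := e', left_inv := fun u => rfl, right_inv := fun w => rfl }
  calc ∑ w : {w : ι → placesOver K p // ∀ a, finBelow F₀ K (w a).1 = (v a).1}, ∏ a, weight K (w.1 a).1
      = ∑ w : ↥T, ∏ a, weight K (w.1 a) :=
        Fintype.sum_equiv E _ (fun w : ↥T => ∏ a, weight K (w.1 a)) fun u => rfl
    _ = ∑ w ∈ T, ∏ a, weight K (w a) := Finset.sum_coe_sort T (fun w => ∏ a, weight K (w a))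
    _ = ∏ a, weight F₀ (v a).1 := sum_piFinset_prod_weight_eq F₀ K (fun a => (v a).1) (fun a => (v a).2)

end Literature.IUT.LogVolume

end
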